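import Summits.BirchSwinnertonDyer.BirchSwinnertonDyer.Theorems.PrintCf2SplitBadTwoLocalControlKernelGood
import Summits.BirchSwinnertonDyer.BirchSwinnertonDyer.Theorems.PrintCf2SplitBadTwoIndexTwoResZero
import Literature.NumberTheory.EllipticCurves.SubgroupSelmerCocycleCriteriaProofs
import Literature.NumberTheory.EllipticCurves.SelmerCorankProofs
import HarnessLib

/-!
# Crux `PrintCf2.SplitBadTwoRankOneOfFacts` (stmt-BirchSwinnertonDyer-20368), road α v12, the étale brick (ET):
# GENERATION AND INFLATION — everything after «the Kummer cocycle on `I_L` lands in the kernel line»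

Cell `bsd-print-cf2`, EXTRA WIDTH seat `bsd-line-cf2-p1-w4` g10 (prover-bsd-line-cf2-p1-w4-g10-0); `--supports stmt-BirchSwinnertonDyer-20368`
(helper, Theses-free). HONEST FRAMING: nothing here closes the crux or a registered stub; BSD is not proved by any of this; no summit
`Statement.lean` is touched; no `sorry`, no new axiom, no Literature fact, no definition.

## What is proved (TURNKEY-20368-ET-w3g10 §2, pieces (B2) + (A) + assembly; piece (B1) = the kernel-line identification is -w8 g3's)

The étale brick (ET-w) says that the `W*`-component of every Kummer class is `2`-torsion on `D_w`. Greenberg's argument (LNM 1716 §2,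
Props. 2.1–2.4): over `L_w = K_w(√d)` the curve has good ordinary reduction, so for `σ` in the inertia group `I_L` of `L_w` and `2^n R = Q`
the point `σR − R` lies in the kernel-of-reduction line, which the projector `e` kills — that is (B1), an arithmetic input here; THEN the
`e`-component cocycle restricted to `D_L = D_w ∩ Γ_L` is unramified, and `H¹(D_L/I_L, W*) = W*/(F − 1)W* = 0` for the Frobenius `F`
(`W*` divisible, `F` acts by a unit `≠ 1`) — that is (B2); FINALLY `[D_w : D_L] = 2` gives `2 •` the class `= 0` on `D_w` (cores ∘ res) — that
is (A), -w2 g12's `IndexTwoRes.index_nsmul_eq_zero_of_resOfLe_eq_zero`. This file proves (B2) and the assembly GENERICALLY: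

* §1 `eq_zero_of_resSubgroup_eq_zero_of_generate` (G1) — abstract topological group `G`, `N ⊴ G`, `γ ∈ G` such that every open subgroup
  containing `N` and `γ` is `⊤`, `M` a discrete `G`-module with continuous orbits on which `N` acts trivially and `γ − 1` is onto: the
  restriction `H¹(G, M) → H¹(N, M)` is injective (Literature `ResKernel.finite_subgroupResKer`: the kernel embeds in `M^N/(γ − 1)M^N = 0`).
* §2 `generate_of_mul_mem` (G2′) and `generate_subgroupOf_of_isOpen` (G2) — the generation property passes from `(A, N₀, F)` to `(A, N₀, F·n)`
  for `n ∈ N₀`, and to `(B, N₀ ∩ B, F)` for an OPEN `B ≤ A` containing `F` (`N₀ ∩ A ⊴ A`): `U·(N₀ ∩ A)` is an open subgroup of `A`.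
* §3 `resOfLe_proj_kummerMapLevel_eq_zero_of_forall` (K) — the cocycle-to-class step: if `e(i • R − R) = 0` for every `i ∈ I′` and every
  `2^n`-th root `R` of `Q`, then `res_{⊤ ⊓ I′}(e_* res_⊤ κ_n(Q)) = 0` (explicit Kummer cocycle, `resH1Hom_oneCocycleClass_eq_zero_iff`).
* §4 `two_nsmul_resOfLe_decomp_eq_zero_of_resOfLe_inertia_inf_eq_zero` (ASM) — `S ⊴ Γ_K` open with `S.index ∣ 2` (think `S = Γ_{K(√d)}`),
  `w` a finite place, `M` a discrete `Γ_K`-module with continuous orbits fixed pointwise by `inertia w ⊓ S`, and SOME arithmetic Frobenius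
  lift `φ` admitting `F ∈ S ∩ (absGaloisRestrict φ)·(inertia w)` with `F − 1` onto `M`: every `ξ ∈ H¹(⊤, M)` with `res_{⊤ ⊓ (inertia w ⊓ S)} ξ = 0`
  has `2 • res_{⊤ ⊓ decomp w} ξ = 0`. (Generation of `D_w` by inertia and a Frobenius lift: -w2's `exists_frobPow_generator_decomp`.)

So (ET-v) = §4 at `M := ↥W*`, `ξ := e_* res_⊤ κ_n(Q)`, with §3 discharging its hypothesis from (B1) — the remaining ARITHMETIC inputs are
exactly: (B1) «`e(iR − R) = 0` for `i ∈ inertia v ⊓ S`», the local type «a Frobenius in `S` acts on `W*` by a unit `u` with `(u − 1)W* = W*`»,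
and «`inertia v ⊓ S` fixes `W*`» (the pinning: inertia acts through `χ_d`).

[cite: GreenbergLNM1716, §2 Props. 2.1–2.4 (pp. 62–63, 70–75)] [cite: SerreGaloisCohomology1997, I.§2.4 Prop. 9, I.§2.6]
[cite: SerreLocalFields1979, XIII §1 Prop. 1] [cite: NeukirchSchmidtWingberg2008, (1.6.3), Thm. 7.5.3]
-/

noncomputable section

set_option linter.dupNamespace false

open scoped Classical Pointwise

open CategoryTheory Function Field NumberField IsDedekindDomain WeierstrassCurve
open Literature.NumberTheory.EllipticCurves Literature.NumberTheory.EllipticCurves.GreenbergSelmer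
open Literature.NumberTheory.EllipticCurves.ResKernel
open Literature.NumberTheory.EllipticCurves.CocycleCriteria
open Literature.NumberTheory.GaloisRepresentations
open Summit.BirchSwinnertonDyer.BirchSwinnertonDyer.Theorems.PrintCf2.RestrictedSelmerPair

universe u

namespace Summit.BirchSwinnertonDyer.BirchSwinnertonDyer.Theorems.PrintCf2.EtaleGeneration

/-! ## §1. (G1) Injectivity of restriction to a pointwise-trivial normal subgroup with a cogenerator `γ`, `γ − 1` onto -/

section Abstract

variable {G : Type u} [Group G] [TopologicalSpace G] [IsTopologicalGroup G]
variable (N : Subgroup G) (M : Type u) [AddCommGroup M] [DistribMulAction G M] [TopologicalSpace M] [DiscreteTopology M]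

/-- **(G1) Unramified classes die when `γ − 1` is onto.** `N ⊴ G`, `γ ∈ G` with «every open subgroup of `G` containing `N` and `γ` is `⊤`»,
`M` a discrete `G`-module with continuous orbit maps on which `N` acts trivially and `γ − 1` is surjective. Then a class `c ∈ H¹(G, M)` whose
restriction to `N` vanishes is `0`: the kernel of restriction embeds into `M^N/(γ − 1)M^N` (Literature `ResKernel.finite_subgroupResKer`),
and `M^N = M = (γ − 1)M`. The pattern of -w2's `localControlKer_eq_bot_of_surjective`, for an abstract group.
[cite: GreenbergLNM1716, §3 Lemma 3.3 (p. 87)] [cite: SerreLocalFields1979, XIII §1 Prop. 1] [cite: SerreGaloisCohomology1997, I.§2.6] -/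
theorem eq_zero_of_resSubgroup_eq_zero_of_generate [N.Normal] (γ : G)
    (hgen : ∀ U : Subgroup G, IsOpen (U : Set G) → N ≤ U → γ ∈ U → U = ⊤)
    (hcont : ∀ m : M, Continuous fun g : G ↦ g • m)
    (hfix : ∀ n ∈ N, ∀ m : M, n • m = m) (hsurj : ∀ m : M, ∃ y : M, γ • y - y = m)
    (c : discreteH1 G M) (hc : resSubgroup N M c = 0) : c = 0 := by
  have hall : ∀ m : M, m ∈ FixedPoints.addSubgroup N M := fun m ↦
    (FixedPoints.mem_addSubgroup _ _ m).mpr fun x ↦ hfix _ x.2 m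
  have hrange : (subOne N M γ).range = ⊤ := by
    rw [eq_top_iff]
    rintro m -
    obtain ⟨y, hy⟩ := hsurj (m : M)
    refine ⟨⟨y, hall y⟩, Subtype.ext ?_⟩
    rw [coe_subOne_apply]
    exact hy
  haveI : Subsingleton (FixedPoints.addSubgroup N M ⧸ (subOne N M γ).range) := by
    rw [hrange]
    exact QuotientAddGroup.subsingleton_quotient_top
  haveI : Finite (FixedPoints.addSubgroup N M ⧸ (subOne N M γ).range) := Finite.of_subsingleton
  obtain ⟨hfinK, hcardK⟩ := ResKernel.finite_subgroupResKer N M γ hgen hcont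
  haveI := hfinK
  have hle1 : Nat.card (subgroupResKer M N) ≤ 1 :=
    hcardK.trans (Finite.card_le_one_iff_subsingleton.mpr inferInstance)
  have hbot : subgroupResKer M N = ⊥ := (subgroupResKer M N).eq_bot_of_card_le hle1
  have hmem : c ∈ subgroupResKer M N := (mem_subgroupResKer_iff N M c).mpr hc
  rw [hbot] at hmem
  exact hmem

end Abstract

/-! ## §2. (G2) The generation property passes to open subgroups and to `γ·n` -/

section Generation

variable {G : Type u} [Group G] [TopologicalSpace G] [IsTopologicalGroup G]

omit [IsTopologicalGroup G] in
/-- **(G2′)** If every open subgroup of `↥A` containing `N₀ ∩ A` and `F` is `⊤`, the same holds with `F·n` (`n ∈ N₀ ∩ A`) in place of `F`.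
[folklore] [cite: NeukirchSchmidtWingberg2008, Thm. 7.5.3] -/
theorem generate_of_mul_mem {A : Subgroup G} (N₀ : Subgroup G) {F : ↥A}
    (hgen : ∀ U : Subgroup ↥A, IsOpen (U : Set ↥A) → N₀.subgroupOf A ≤ U → F ∈ U → U = ⊤)
    {n : ↥A} (hn : n ∈ N₀.subgroupOf A) :
    ∀ U : Subgroup ↥A, IsOpen (U : Set ↥A) → N₀.subgroupOf A ≤ U → F * n ∈ U → U = ⊤ := fun U hU hNU hFn ↦
  hgen U hU hNU (by simpa only [mul_inv_cancel_right] using U.mul_mem hFn (U.inv_mem (hNU hn)))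

/-- **(G2) Generation passes to an open subgroup containing the cogenerator.** `B ≤ A ≤ G` with `B` open in `↥A`, `N₀ ∩ A ⊴ A`, `F ∈ B`:
if every open subgroup of `↥A` containing `N₀ ∩ A` and `F` is `⊤`, then every open subgroup `U` of `↥B` containing `N₀ ∩ B` and `F` is `⊤`
— the subgroup `U·(N₀ ∩ A)` of `↥A` is open and contains `N₀ ∩ A` and `F`, hence is everything, and `b = u·n` forces `n ∈ N₀ ∩ B ≤ U`.
[folklore] [cite: NeukirchSchmidtWingberg2008, Thm. 7.5.3] -/
theorem generate_subgroupOf_of_isOpen {A B : Subgroup G} (hBA : B ≤ A) (N₀ : Subgroup G) [(N₀.subgroupOf A).Normal]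
    {F : G} (hFA : F ∈ A) (hFB : F ∈ B)
    (hgen : ∀ U : Subgroup ↥A, IsOpen (U : Set ↥A) → N₀.subgroupOf A ≤ U → (⟨F, hFA⟩ : ↥A) ∈ U → U = ⊤)
    (hopen : IsOpen ((B.subgroupOf A : Subgroup ↥A) : Set ↥A)) :
    ∀ U : Subgroup ↥B, IsOpen (U : Set ↥B) → N₀.subgroupOf B ≤ U → (⟨F, hFB⟩ : ↥B) ∈ U → U = ⊤ := by
  intro U hU hNU hFU
  -- push `U` into `↥A` along the inclusion `↥B → ↥A` (an open embedding onto `B.subgroupOf A`)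
  set U' : Subgroup ↥A := U.map (Subgroup.inclusion hBA) with hU'_def
  have hemb : Topology.IsOpenEmbedding (Subgroup.inclusion hBA) := by
    refine ⟨?_, ?_⟩
    · refine Topology.IsEmbedding.of_comp (continuous_inclusion hBA) continuous_subtype_val ?_
      exact Topology.IsEmbedding.subtypeVal
    · have : Set.range (Subgroup.inclusion hBA) = ((B.subgroupOf A : Subgroup ↥A) : Set ↥A) := by
        ext x
        constructor
        · rintro ⟨y, rfl⟩
          exact Subgroup.mem_subgroupOf.mpr y.2
        · intro hx
          exact ⟨⟨(x : G), Subgroup.mem_subgroupOf.mp hx⟩, Subtype.ext rfl⟩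
      rw [this]
      exact hopen
  have hU'open : IsOpen (U' : Set ↥A) := by
    rw [hU'_def, Subgroup.coe_map]
    exact hemb.isOpenMap _ hU
  -- `U' ⊔ (N₀ ∩ A)` is open, contains `N₀ ∩ A` and `F`: it is `⊤`
  have hV : U' ⊔ N₀.subgroupOf A = ⊤ :=
    hgen _ (Subgroup.isOpen_mono le_sup_left hU'open) le_sup_right
      (Subgroup.mem_sup_left (Subgroup.mem_map.mpr ⟨⟨F, hFB⟩, hFU, rfl⟩))
  -- decompose `b = u · n`
  rw [eq_top_iff]
  rintro ⟨b, hb⟩ -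
  have hmem : (⟨b, hBA hb⟩ : ↥A) ∈ ((U' ⊔ N₀.subgroupOf A : Subgroup ↥A) : Set ↥A) := by
    rw [hV]; exact Subgroup.mem_top _
  rw [Subgroup.mul_normal] at hmem
  obtain ⟨u, hu, n, hn, hun⟩ := Set.mem_mul.mp hmem
  obtain ⟨u₀, hu₀, rfl⟩ := Subgroup.mem_map.mp hu
  have hnB : ((n : ↥A) : G) ∈ B := by
    have hn' : (n : ↥A) = (Subgroup.inclusion hBA u₀)⁻¹ * ⟨b, hBA hb⟩ := eq_inv_mul_of_mul_eq hun
    rw [hn', Subgroup.coe_mul, Subgroup.coe_inv]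
    exact B.mul_mem (B.inv_mem u₀.2) hb
  have hnU : (⟨(n : G), hnB⟩ : ↥B) ∈ U := hNU (Subgroup.mem_subgroupOf.mpr (Subgroup.mem_subgroupOf.mp hn))
  have hb' : (⟨b, hb⟩ : ↥B) = u₀ * ⟨(n : G), hnB⟩ :=
    Subtype.ext (by rw [Subgroup.coe_mul]; exact (congrArg Subtype.val hun).symm)
  rw [hb']
  exact U.mul_mem hu₀ hnU

end Generation

/-! ## §3. (K) From «`e(iR − R) = 0` on `I′`» to the vanishing of the restricted class -/

section Kummer

variable {K : Type u} [Field K] (V : WeierstrassCurve K) [V.IsElliptic] (p : ℕ) [Fact p.Prime]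
  (hdiv : V.zsmul_geomPoints_surjective)
  {M : Type u} [AddCommGroup M] [DistribMulAction (absoluteGaloisGroup K) M] [TopologicalSpace M] [DiscreteTopology M]

/-- **(K) The cocycle-to-class step.** `e : E[p^∞] → M` an equivariant additive map, `I′ ≤ Γ_K`, `Q ∈ E(K)`, `n`. IF for every `p^n`-th root
`R` of `Q`, every `i ∈ I′` and every `m ∈ E[p^∞]` with `m = iR − R` one has `e m = 0`, THEN the restriction to `⊤ ⊓ I′` of the class
`e_* res_⊤ κ_n(Q) ∈ H¹(⊤, M)` vanishes: `κ_n(Q)` is the class of the explicit cocycle `g ↦ gR − R` (`kummerMapLevel_eq_kummerClass`), the three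
maps compose to one `resH1Hom`, and a cocycle with vanishing values is principal (`resH1Hom_oneCocycleClass_eq_zero_iff` with `n := 0`).
[cite: GreenbergLNM1716, §2 (p. 62, the Kummer cocycle)] [cite: SerreGaloisCohomology1997, I.§2.4] -/
theorem resOfLe_proj_kummerMapLevel_eq_zero_of_forall (e : V.geomPrimaryTorsion p →+ M)
    (he : ∀ (σ : absoluteGaloisGroup K) (x : V.geomPrimaryTorsion p), e (σ • x) = σ • e x)
    (I' : Subgroup (absoluteGaloisGroup K)) (n : ℕ) (Q : V.toAffine.Point)
    (hB1 : ∀ R : V.geomPoints, p ^ n • R = toGeomPoints V Q →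
      ∀ i ∈ I', ∀ m : V.geomPrimaryTorsion p, (m : V.geomPoints) = i • R - R → e m = 0) :
    resOfLe M (inf_le_left : (⊤ : Subgroup (absoluteGaloisGroup K)) ⊓ I' ≤ ⊤)
      (resH1Hom (ContinuousMonoidHom.id (⊤ : Subgroup (absoluteGaloisGroup K))) e (fun σ x ↦ he σ x)
        (resSubgroup ⊤ (V.geomPrimaryTorsion p) (V.kummerMapLevel p hdiv n Q))) = 0 := by
  -- values of the Kummer cocycle on `I′` are killed by `e`
  have key : ∀ σ : absoluteGaloisGroup K, σ ∈ I' →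
      e ((kummerCocycle V p n (kummerRoot V p hdiv n Q) (smul_nsmul_of_nsmul_eq V p (nsmul_kummerRoot V p hdiv n Q))).1 σ) = 0 :=
    fun σ hσ ↦ hB1 _ (nsmul_kummerRoot V p hdiv n Q) σ hσ _ (coe_kummerCocycle_apply V p n _ _ σ)
  -- the three maps compose to one `resH1Hom`
  rw [← AddMonoidHom.comp_apply, ← AddMonoidHom.comp_apply]
  unfold Literature.NumberTheory.EllipticCurves.resOfLe ResKernel.resSubgroup
  rw [resH1Hom_comp, resH1Hom_comp, kummerMapLevel_eq_kummerClass V p hdiv n Q (kummerRoot V p hdiv n Q) (nsmul_kummerRoot V p hdiv n Q)]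
  unfold kummerClass
  refine (CocycleCriteria.resH1Hom_oneCocycleClass_eq_zero_iff _ _ _ _).mpr ⟨0, fun x ↦ ?_⟩
  rw [smul_zero, sub_zero]
  exact key (x : absoluteGaloisGroup K) (Subgroup.mem_inf.mp x.2).2

end Kummer

/-! ## §4. (ASM) `res_{⊤ ⊓ (inertia w ⊓ S)} ξ = 0 ⟹ 2 • res_{⊤ ⊓ decomp w} ξ = 0` -/

section Assembly

variable {K : Type u} [Field K] [NumberField K]
  (M : Type u) [AddCommGroup M] [DistribMulAction (absoluteGaloisGroup K) M] [TopologicalSpace M] [DiscreteTopology M]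
  (w : HeightOneSpectrum (𝓞 K))

/-- **(ASM) = (B2) + (A) on the decomposition group.** `S ⊴ Γ_K` open with `S.index ∣ 2` (think `S = Γ_{K(√d)}`), `w` a finite place,
`M` a discrete `Γ_K`-module with continuous orbits, pointwise fixed by `inertia w ⊓ S`; suppose that for every arithmetic Frobenius lift
`φ ∈ Γ_{K_w}` (`IsFrobPow φ 1`) there is `F ∈ S` in the coset `(absGaloisRestrict φ)·(inertia w)` with `F − 1` ONTO `M`. Then every
`ξ ∈ H¹(⊤, M)` whose restriction to `⊤ ⊓ (inertia w ⊓ S)` vanishes has `2 • res_{⊤ ⊓ decomp w} ξ = 0`. PROOF: `D_L := (⊤ ⊓ decomp w) ⊓ S` is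
open in `D := ⊤ ⊓ decomp w` and generated by `inertia w ∩ D_L` and `F` (§2 on -w2's `exists_frobPow_generator_decomp`); (G1) kills `res_{D_L} ξ`;
`[D : D_L] ∣ 2` and -w2 g12's `IndexTwoRes.index_nsmul_eq_zero_of_resOfLe_eq_zero` finish.
[cite: GreenbergLNM1716, §2 Props. 2.1–2.4] [cite: SerreGaloisCohomology1997, I.§2.4 Prop. 9, I.§2.6] [cite: NeukirchSchmidtWingberg2008, Thm. 7.5.3] -/
theorem two_nsmul_resOfLe_decomp_eq_zero_of_resOfLe_inertia_inf_eq_zero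
    (hcont : ∀ m : M, Continuous fun g : absoluteGaloisGroup K ↦ g • m)
    (S : Subgroup (absoluteGaloisGroup K)) [S.Normal] (hSopen : IsOpen (S : Set (absoluteGaloisGroup K))) (hS2 : S.index ∣ 2)
    (hfix : ∀ τ ∈ GreenbergSelmer.inertia w ⊓ S, ∀ m : M, τ • m = m)
    (hF : ∀ φ : absoluteGaloisGroup (w.adicCompletion K), IsFrobPow φ 1 →
      ∃ F ∈ S, (absGaloisRestrict K (w.adicCompletion K) φ)⁻¹ * F ∈ GreenbergSelmer.inertia w ∧ ∀ m : M, ∃ y : M, F • y - y = m)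
    (ξ : subgroupH1 (⊤ : Subgroup (absoluteGaloisGroup K)) M)
    (hξ : resOfLe M (inf_le_left : (⊤ : Subgroup (absoluteGaloisGroup K)) ⊓ (GreenbergSelmer.inertia w ⊓ S) ≤ ⊤) ξ = 0) :
    2 • resOfLe M (inf_le_left : (⊤ : Subgroup (absoluteGaloisGroup K)) ⊓ decomp w ≤ ⊤) ξ = 0 := by
  set D : Subgroup (absoluteGaloisGroup K) := (⊤ : Subgroup (absoluteGaloisGroup K)) ⊓ decomp w with hD_def
  set DL : Subgroup (absoluteGaloisGroup K) := D ⊓ S with hDL_def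
  have hDd : D ≤ decomp w := inf_le_right
  have hdD : decomp w ≤ D := le_inf le_top le_rfl
  have hDL_D : DL ≤ D := inf_le_left
  have hDL_d : DL ≤ decomp w := hDL_D.trans hDd
  have hDL_top : DL ≤ ⊤ := le_top
  have hD_top : D ≤ ⊤ := le_top
  -- Step 1: `D` is generated by inertia and a Frobenius lift; move the cogenerator into `S` and down to `DL`
  obtain ⟨φ, hφ, hF₀D, hgenD⟩ := exists_frobPow_generator_decomp w hDd hdD
  obtain ⟨F, hFS, hFI, hsurj⟩ := hF φ hφ
  have hiD : (absGaloisRestrict K (w.adicCompletion K) φ)⁻¹ * F ∈ D := hdD (GreenbergSelmer.inertia_le_decomp w hFI)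
  have hFD : F ∈ D := by
    have hmul := D.mul_mem hF₀D hiD
    rwa [mul_inv_cancel_left] at hmul
  have hFDL : F ∈ DL := ⟨hFD, hFS⟩
  haveI : ((GreenbergSelmer.inertia w).subgroupOf D).Normal := normal_inertia_subgroupOf w hDd
  haveI : ((GreenbergSelmer.inertia w).subgroupOf DL).Normal := normal_inertia_subgroupOf w hDL_d
  have hEq : (⟨absGaloisRestrict K (w.adicCompletion K) φ, hF₀D⟩ : ↥D) * ⟨(absGaloisRestrict K (w.adicCompletion K) φ)⁻¹ * F, hiD⟩ =
      ⟨F, hFD⟩ := Subtype.ext (mul_inv_cancel_left _ _)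
  have hgenF : ∀ U : Subgroup ↥D, IsOpen (U : Set ↥D) → (GreenbergSelmer.inertia w).subgroupOf D ≤ U → (⟨F, hFD⟩ : ↥D) ∈ U → U = ⊤ := by
    rw [← hEq]
    exact generate_of_mul_mem (GreenbergSelmer.inertia w) hgenD (Subgroup.mem_subgroupOf.mpr hFI)
  have hopenDL : IsOpen ((DL.subgroupOf D : Subgroup ↥D) : Set ↥D) := by
    have hset : ((DL.subgroupOf D : Subgroup ↥D) : Set ↥D) = Subtype.val ⁻¹' (S : Set (absoluteGaloisGroup K)) := by
      ext x
      simp only [SetLike.mem_coe, Subgroup.mem_subgroupOf, hDL_def, Subgroup.mem_inf, Set.mem_preimage]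
      exact ⟨fun h ↦ h.2, fun h ↦ ⟨x.2, h⟩⟩
    rw [hset]
    exact hSopen.preimage continuous_subtype_val
  have hgenDL := generate_subgroupOf_of_isOpen hDL_D (GreenbergSelmer.inertia w) hFD hFDL hgenF hopenDL
  -- Step 2: (G1) on `↥DL`: `res_{DL} ξ = 0`
  have hcont' : ∀ m : M, Continuous fun g : ↥DL ↦ g • m := fun m ↦ (hcont m).comp continuous_subtype_val
  have hfix' : ∀ n ∈ (GreenbergSelmer.inertia w).subgroupOf DL, ∀ m : M, n • m = m := fun n hn m ↦
    hfix (n : (absoluteGaloisGroup K)) ⟨Subgroup.mem_subgroupOf.mp hn, n.2.2⟩ m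
  have hsurj' : ∀ m : M, ∃ y : M, (⟨F, hFDL⟩ : ↥DL) • y - y = m := hsurj
  -- the restriction of `res_{DL} ξ` to the inertia of `DL` factors through `res_{⊤ ⊓ (inertia w ⊓ S)} ξ = 0`
  let j : ↥((GreenbergSelmer.inertia w).subgroupOf DL) →ₜ* ↥((⊤ : Subgroup (absoluteGaloisGroup K)) ⊓ (GreenbergSelmer.inertia w ⊓ S)) :=
    { toFun := fun x ↦ ⟨((x : ↥DL) : (absoluteGaloisGroup K)), ⟨Subgroup.mem_top _, Subgroup.mem_subgroupOf.mp x.2, (x : ↥DL).2.2⟩⟩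
      map_one' := rfl
      map_mul' := fun _ _ ↦ rfl
      continuous_toFun := (continuous_subtype_val.comp continuous_subtype_val).subtype_mk _ }
  have hcomp : (resH1Hom j (AddMonoidHom.id M) (fun _ _ ↦ rfl)).comp
      (resOfLe M (inf_le_left : (⊤ : Subgroup (absoluteGaloisGroup K)) ⊓ (GreenbergSelmer.inertia w ⊓ S) ≤ ⊤)) =
      (resSubgroup ((GreenbergSelmer.inertia w).subgroupOf DL) M).comp (resOfLe M hDL_top) := by
    unfold Literature.NumberTheory.EllipticCurves.resOfLe ResKernel.resSubgroup
    rw [resH1Hom_comp, resH1Hom_comp]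
    exact resH1Hom_congr (ContinuousMonoidHom.ext fun _ ↦ rfl) (AddMonoidHom.ext fun _ ↦ rfl) _ _
  have hc : resSubgroup ((GreenbergSelmer.inertia w).subgroupOf DL) M (resOfLe M hDL_top ξ) = 0 := by
    have happ := congrArg (fun f ↦ f ξ) hcomp
    simp only [AddMonoidHom.comp_apply] at happ
    rw [← happ, hξ, map_zero]
  have hzero : resOfLe M hDL_top ξ = 0 :=
    eq_zero_of_resSubgroup_eq_zero_of_generate _ M ⟨F, hFDL⟩ hgenDL hcont' hfix' hsurj' _ hc
  -- Step 3: `[D : DL] ∣ 2`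
  have hres : resOfLe M hDL_D (resOfLe M hD_top ξ) = 0 := by
    rw [← AddMonoidHom.comp_apply, Literature.NumberTheory.EllipticCurves.resOfLe_comp_holds]
    exact hzero
  have hsub : DL.subgroupOf D = S.subgroupOf D := by
    rw [hDL_def]
    exact Subgroup.inf_subgroupOf_left _ _
  have hidx : (DL.subgroupOf D).index ∣ 2 := by
    rw [hsub]
    exact (Subgroup.relIndex_dvd_index_of_normal S D).trans hS2
  haveI : Fintype (↥D ⧸ DL.subgroupOf D) :=
    Subgroup.fintypeOfIndexNeZero (fun h0 ↦ by rw [h0] at hidx; exact absurd hidx (by decide))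
  have hkill := IndexTwoRes.index_nsmul_eq_zero_of_resOfLe_eq_zero hDL_D hopenDL _ hres
  rcases (Nat.dvd_prime Nat.prime_two).mp hidx with h1 | h2
  · rw [h1, one_nsmul] at hkill
    rw [hkill, nsmul_zero]
  · rwa [h2] at hkill

end Assembly

/-! ## §5. The étale brick (ET-w) from its three arithmetic inputs -/

section Frame

variable {K : Type u} [Field K] [NumberField K] (V : WeierstrassCurve K) [V.IsElliptic] (w : HeightOneSpectrum (𝓞 K))
  (π : V.endRing) (r r' : ℤ_[2])

/-- **(ET-w) from (B1), the Frobenius surjectivity and the triviality of `I_L` on `W*`.** `V/K` elliptic (think `E = W_K`), `w` a finite place,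
`W* := V.endEigenPrimaryTorsion 2 π r`, `W*′ := V.endEigenPrimaryTorsion 2 π r'`, `S ⊴ Γ_K` open of index `∣ 2` (think `Γ_{K(√d)}`). IF
(pin) `inertia w ⊓ S` fixes `W*` pointwise, (frob) every arithmetic Frobenius lift has a translate `F ∈ S` by inertia with `F − 1` onto `W*`, and
(B1) for every equivariant projector `e` onto `W*` killing `W*′`, every `Q ∈ E(K)`, `n`, every `2^n`-th root `R` of `Q` and every `i ∈ inertia w ⊓ S`:
`e(iR − R) = 0` — THEN (ET-w): `2 • res_{⊤ ⊓ D_w}(e_* res_⊤ κ_n(Q)) = 0` for all such `e, Q, n` (the text of -w3 g10's `hET` at `(v, r, 1 − r)`,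
for `V := W.baseChange K`). §4 with `ξ := e_* res_⊤ κ_n(Q)` and §3.
[cite: GreenbergLNM1716, §2 Props. 2.1–2.4 (pp. 62–63, 70–75)] [cite: SerreGaloisCohomology1997, I.§2.4 Prop. 9] -/
theorem two_nsmul_resOfLe_proj_kummer_eq_zero_of_inputs
    (S : Subgroup (absoluteGaloisGroup K)) [S.Normal] (hSopen : IsOpen (S : Set (absoluteGaloisGroup K))) (hS2 : S.index ∣ 2)
    (hpin : ∀ τ ∈ GreenbergSelmer.inertia w ⊓ S, ∀ x : ↥(V.endEigenPrimaryTorsion 2 π r), τ • x = x)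
    (hfrob : ∀ φ : absoluteGaloisGroup (w.adicCompletion K), IsFrobPow φ 1 →
      ∃ F ∈ S, (absGaloisRestrict K (w.adicCompletion K) φ)⁻¹ * F ∈ GreenbergSelmer.inertia w ∧
        ∀ m : ↥(V.endEigenPrimaryTorsion 2 π r), ∃ y : ↥(V.endEigenPrimaryTorsion 2 π r), F • y - y = m)
    (hB1 : ∀ (e : V.geomPrimaryTorsion 2 →+ ↥(V.endEigenPrimaryTorsion 2 π r))
        (_ : ∀ x : ↥(V.endEigenPrimaryTorsion 2 π r), e x = x)
        (_ : ∀ x ∈ V.endEigenPrimaryTorsion 2 π r', e x = 0)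
        (_ : ∀ (σ : absoluteGaloisGroup K) (x : V.geomPrimaryTorsion 2), e (σ • x) = σ • e x)
        (Q : V.toAffine.Point) (n : ℕ) (R : V.geomPoints), 2 ^ n • R = toGeomPoints V Q →
        ∀ i ∈ GreenbergSelmer.inertia w ⊓ S, ∀ m : V.geomPrimaryTorsion 2, (m : V.geomPoints) = i • R - R → e m = 0) :
    ∀ (e : V.geomPrimaryTorsion 2 →+ ↥(V.endEigenPrimaryTorsion 2 π r))
        (he₁ : ∀ x : ↥(V.endEigenPrimaryTorsion 2 π r), e x = x)
        (he0 : ∀ x ∈ V.endEigenPrimaryTorsion 2 π r', e x = 0)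
        (he : ∀ (σ : absoluteGaloisGroup K) (x : V.geomPrimaryTorsion 2), e (σ • x) = σ • e x)
        (Q : V.toAffine.Point) (n : ℕ),
        2 • resOfLe ↥(V.endEigenPrimaryTorsion 2 π r) (inf_le_left : ⊤ ⊓ decomp w ≤ ⊤)
          (resH1Hom (ContinuousMonoidHom.id (⊤ : Subgroup (absoluteGaloisGroup K))) e (fun σ x ↦ he σ x)
            (resSubgroup ⊤ (V.geomPrimaryTorsion 2) (V.kummerMapLevel 2 V.zsmul_geomPoints_surjective_holds n Q))) = 0 := by
  intro e he₁ he0 he Q n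
  haveI : Fact (Nat.Prime 2) := ⟨Nat.prime_two⟩
  have hcont : ∀ m : ↥(V.endEigenPrimaryTorsion 2 π r), Continuous fun g : (absoluteGaloisGroup K) ↦ g • m := fun m ↦
    continuous_of_injective_comp (G := absoluteGaloisGroup K) (ι := ((↑) : ↥(V.endEigenPrimaryTorsion 2 π r) → V.geomPrimaryTorsion 2))
      Subtype.val_injective (V.continuous_smul_geomPrimaryTorsion 2 (m : V.geomPrimaryTorsion 2))
  exact two_nsmul_resOfLe_decomp_eq_zero_of_resOfLe_inertia_inf_eq_zero _ w hcont S hSopen hS2 hpin hfrob _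
    (resOfLe_proj_kummerMapLevel_eq_zero_of_forall V 2 V.zsmul_geomPoints_surjective_holds e he (GreenbergSelmer.inertia w ⊓ S) n Q
      (hB1 e he₁ he0 he Q n))

end Frame

end Summit.BirchSwinnertonDyer.BirchSwinnertonDyer.Theorems.PrintCf2.EtaleGeneration

end
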